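import Literature.Analysis.FluidPDE.LerayHopfBoundedWindowRegular
import Literature.Analysis.FluidPDE.CheskidovShvydkoyHolds
import HarnessLib

/-!
# Fluid computer — transporting the block energy balance to a maximal smooth finite-energy solution

HONEST FRAMING (cell `pub-fluidc`, verbatim): *low prior, high value-of-information experiment on Tao's
machine paradigm; NOT a claim that NS blows up.* Theorem side of the cell (support file of the TRANSFER floor L12,
`LevelTransferFloor`); nothing here is evidence of blow-up.

The exact block energy balance of the tree (`IsSmoothSlabSolution.blockEnergy_eq`, Cheskidov–Shvydkoy 2010, proof of
Lemma 3.2, (8): `‖Δ̇_j v(t)‖₂² − ‖Δ̇_j v(s)‖₂² = 2 ∫ₛᵗ (−ν ∑_i ‖∂_i Δ̇_j v‖₂² − N_j(v(τ))) dτ` with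
`N_j(w) := ∫ ⟪Δ̇_j w, Δ̇_j ((w·∇) w)⟫`) is stated for SMOOTH SLAB solutions — velocity and pressure with all
derivatives bounded and square integrable on a closed time slab. A maximal smooth solution
(`IsMaximalSmoothSolution`: classical on `[0, T)`, no classical continuation past `T`) carries no such bounds a priori.
This file transports the balance, with its viscous term dropped and the transfer term kept as the lower Lebesgue
integral of its positive part (so that NO integrability bookkeeping is exported), to every maximal smooth solution that
is Leray–Hopf from `u 0`, on every compact sub-interval of the open lifespan:

* `piece_blockEnergy` — the LOCAL STEP from a good restarting time `σ`: Leray's regular local solution `v` from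
  `u(σ)` (`leray_local_regular_H1_holds`, lifespan `d` with `‖∇u(σ)‖₂⁴ d ≤ c₀ ν³`) coincides with `u(σ + ·)` almost
  everywhere by Serrin's weak–strong uniqueness (`serrin_weak_strong_uniqueness_holds`, `v ∈ L^∞_t H¹ ⊂ L^∞_t L⁶`),
  hence EVERYWHERE (both slices are continuous); so the slices `u(τ)`, `τ ∈ (σ, σ + d]`, are smooth `L²` fields and
  `‖Δ̇_j u(t)‖₂² ≤ ‖Δ̇_j u(s)‖₂² + 2 ∫⁻_{(s,t]} (−N_j(u(τ)))⁺ dτ` for `σ < s ≤ t ≤ σ + d`;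
* `isSmoothL2Field_slice_of_maximal` — every slice `u(τ)`, `0 < τ < T`, is a smooth `L²` field (all derivatives
  bounded and square integrable): the BKM-class hypothesis used by `VorticityOccupationWindow` /
  `SummedOccupationBridge` holds slice by slice on the open lifespan, as a theorem;
* `blockL2_sq_le_add_transfer` — the local step COVERED over every compact `[s, t] ⊂ (0, T)`: a uniform `H¹` bound on
  `[s/2, t]` (`IsMaximalSmoothSolution.isH1RegularOn_Ioo`, Robinson–Rodrigo–Sadowski Thm. 8.17 in the tree) gives a
  uniform Leray lifespan, good restarting times are dense (`IsLerayHopfOn.exists_isLerayHopfOn_restart_Ioo`), pieces of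
  half a lifespan are chained and the lower integrals add over adjacent intervals:
  `‖Δ̇_j u(t)‖₂² ≤ ‖Δ̇_j u(s)‖₂² + 2 ∫⁻_{(s,t]} (−N_j(u(τ)))⁺ dτ` — a block holds at time `t` at most what it held at
  time `s` plus twice the positive part of the nonlinear transfer into it in between.

0 sorry; no new definitions, no named facts (inputs: `leray_local_regular_H1_holds`,
`serrin_weak_strong_uniqueness_holds`, `isSmoothSlabSolution_of_regular`, `IsSmoothSlabSolution.blockEnergy_eq`,
`IsMaximalSmoothSolution.isH1RegularOn_Ioo`).

## References

* A. Cheskidov, R. Shvydkoy, *The regularity of weak solutions of the 3D Navier–Stokes equations in `B^{-1}_{∞,∞}`*,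
  Arch. Ration. Mech. Anal. 195 (2010) 159–169 = arXiv:0708.3067, Lemma 3.2 and its proof, (8). [CheskidovShvydkoy2010]
* J. C. Robinson, J. L. Rodrigo, W. Sadowski, *The Three-Dimensional Navier–Stokes Equations*, CUP 2016, Thm. 6.10,
  Thm. 6.15, Lemma 8.4, Thm. 8.17. [RobinsonRodrigoSadowski2016]
* W. S. Ożański, B. C. Pooley, *Leray's fundamental work on the Navier–Stokes equations*, LMS LN 452 (2018),
  Thm. 6.30, Cor. 6.16. [OzanskiPooley2018]
-/

noncomputable section

open MeasureTheory Set Function Filter Topology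
open scoped ENNReal NNReal RealInnerProductSpace
open Literature.Analysis.FluidPDE Literature.Analysis.FunctionSpaces

namespace Summit.NavierStokesRegularity.FluidComputer.BlockEnergyTransport

/-! ## The local transport step: Leray's regular solution from a good time carries the block balance -/

/-- **The local transport step.** Let `(u, p)` be a classical solution of the unforced Navier–Stokes system on
`ℝ³ × [0, T)` (`ν > 0`) which is Leray–Hopf from `u 0`, let `σ ∈ (0, T)` be a good restarting time (the translate is
Leray–Hopf from `u σ`) with `‖∇u(σ)‖₂² ≤ A`, and let `d > 0` with `σ + d ≤ T` and `A² d ≤ c₀ ν³`, where `c₀` is a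
constant of Leray's regular local `H¹` theory (`LerayLocalRegularH1With c₀`). Then Leray's regular solution `v` from
`u(σ)` on `(0, d]` equals `u(σ + ·)` a.e. (Serrin weak–strong uniqueness in `L^∞_t L⁶_x`), hence pointwise (continuity),
and consequently: (i) every slice `u(τ)`, `τ ∈ (σ, σ + d]`, `τ < T`, is a smooth `L²` field; (ii) for
`σ < s ≤ t ≤ σ + d`, `t < T`, and every level `j`, the block energy balance of the smooth slab
(`IsSmoothSlabSolution.blockEnergy_eq`, Cheskidov–Shvydkoy 2010 (8)) with its viscous term dropped reads
`‖Δ̇_j u(t)‖₂² ≤ ‖Δ̇_j u(s)‖₂² + 2 ∫⁻_{(s,t]} (−N_j(u(τ)))⁺ dτ`, `N_j(w) = ∫ ⟪Δ̇_j w, Δ̇_j((w·∇)w)⟫`.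
[cite: CheskidovShvydkoy2010, Lemma 3.2 (proof, (8))] -/
theorem piece_blockEnergy {ν T : ℝ} (hν : 0 < ν)
    {u : ℝ → EuclideanSpace ℝ (Fin 3) → EuclideanSpace ℝ (Fin 3)} {p : ℝ → EuclideanSpace ℝ (Fin 3) → ℝ}
    (hcl : IsClassicalNSSolutionOn (Ico 0 T) ν 0 u p) (hLH : IsLerayHopfOn T ν 0 (u 0) u)
    {c₀ : ℝ} (hreg : LerayLocalRegularH1With c₀)
    {σ : ℝ} (hσ : σ ∈ Ioo 0 T) (hLHσ : IsLerayHopfOn (T - σ) ν 0 (u σ) (fun t => u (t + σ)))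
    {A d : ℝ} (hA : 0 ≤ A) (hAσ : eWeakGradL2Sq (u σ) ≤ ENNReal.ofReal A) (hd : 0 < d) (hσd : σ + d ≤ T)
    (hAd : A ^ 2 * d ≤ c₀ * ν ^ 3) :
    (∀ τ ∈ Ioc σ (σ + d), τ < T → IsSmoothL2Field (u τ)) ∧
    (∀ s t : ℝ, σ < s → s ≤ t → t ≤ σ + d → t < T → ∀ j : ℤ,
      blockL2 (u t) j ^ 2 ≤ blockL2 (u s) j ^ 2 +
        2 * ∫⁻ τ in Ioc s t, ENNReal.ofReal
          (-(∫ x, ⟪blockFn j (u τ) x, blockFn j (convect (u τ) (u τ)) x⟫))) := by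
  have hu2 : MemLp (u σ) 2 volume := hLH.memLp σ ⟨hσ.1.le, hσ.2.le⟩
  have hdiv : IsWeaklyDivFree (u σ) := hLHσ.isWeaklyDivFree_datum (sub_pos.2 hσ.2)
  obtain ⟨v, q, hv, -, hvreg, hns, hclv⟩ := hreg hν hd hu2 hdiv hA hAσ hAd
  -- weak–strong uniqueness on `(0, d]`
  have hLHσ' : IsLerayHopfOn d ν 0 (u σ) (fun t => u (t + σ)) := hLHσ.of_le (by linarith)
  have hS : MemLqLp ∞ 6 v (Ioo 0 d) :=
    memLqLp_top_six_of_isH1RegularOn_Icc hvreg fun t ht => hv.memLp t ht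
  have hqr : 2 / (∞ : ℝ≥0∞) + 3 / 6 ≤ 1 := by
    rw [ENNReal.div_top, zero_add]
    exact ENNReal.div_le_of_le_mul (by norm_num)
  have hae : ∀ t ∈ Ioc 0 d, u (t + σ) =ᵐ[volume] v t := fun t ht =>
    serrin_weak_strong_uniqueness_holds hν hd hv hu2 (q := ∞) (r := 6) (by norm_num) hqr hS hLHσ' t ht
  -- pointwise equality of the continuous slices
  have heq : ∀ τ ∈ Ioc σ (σ + d), τ < T → u τ = v (τ - σ) := by
    intro τ hτ hτT
    have h1 : u τ =ᵐ[volume] v (τ - σ) := by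
      have h := hae (τ - σ) ⟨sub_pos.2 hτ.1, by linarith [hτ.2]⟩
      rwa [sub_add_cancel] at h
    have hcu : Continuous (u τ) := (hcl.contDiff_velocity ⟨hσ.1.le.trans hτ.1.le, hτT⟩).continuous
    have hcv : Continuous (v (τ - σ)) :=
      (hns.contDiff_velocity ⟨sub_pos.2 hτ.1, by linarith [hτ.2]⟩).continuous
    exact (Continuous.ae_eq_iff_eq volume hcu hcv).1 h1
  refine ⟨fun τ hτ hτT => ?_, fun s t hs hst htd htT j => ?_⟩
  · obtain ⟨hSob, -, hsup, -⟩ := hclv (τ - σ) (sub_pos.2 hτ.1) (by linarith [hτ.2])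
    rw [heq τ hτ hτT]
    exact isSmoothL2Field_slice_of_regular hns (sub_pos.2 hτ.1) hSob hsup ⟨le_rfl, by linarith [hτ.2]⟩
  · rcases hst.eq_or_lt with rfl | hst'
    · simp only [Ioc_self, Measure.restrict_empty, lintegral_zero_measure, mul_zero, add_zero, le_refl]
    -- the smooth slab `[s - σ, t - σ]` of `v`
    have ha' : 0 < s - σ := sub_pos.2 hs
    have hab' : s - σ < t - σ := by linarith
    have hb'd : t - σ ≤ d := by linarith
    obtain ⟨hSob, hSobdt, hsup, hp⟩ := hclv (s - σ) ha' (hab'.le.trans hb'd)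
    have hslab : IsSmoothSlabSolution (s - σ) (t - σ) ν v q :=
      isSmoothSlabSolution_of_regular hns ha' hab' hb'd hSob hSobdt hsup hp
    have hE := hslab.blockEnergy_eq j le_rfl hab'.le le_rfl
    -- names
    set g : ℝ → ℝ := fun τ => -ν * (∑ i, ∫ x, ‖fderiv ℝ (blockFn j (v τ)) x
        (stdOrthonormalBasis ℝ (EuclideanSpace ℝ (Fin 3)) i)‖ ^ 2) -
      ∫ x, ⟪blockFn j (v τ) x, blockFn j (convect (v τ) (v τ)) x⟫ with hg
    set G : ℝ → ℝ≥0∞ := fun τ => ENNReal.ofReal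
      (-(∫ x, ⟪blockFn j (v τ) x, blockFn j (convect (v τ) (v τ)) x⟫)) with hG
    have hut : u t = v (t - σ) := heq t ⟨hs.trans hst', htd⟩ htT
    have hus : u s = v (s - σ) := heq s ⟨hs, hst'.le.trans htd⟩ (hst'.trans htT)
    -- block energies as real integrals
    have hsm_t : IsSmoothL2Field (v (t - σ)) := hslab.smooth_slice _ ⟨hab'.le, le_rfl⟩
    have hsm_s : IsSmoothL2Field (v (s - σ)) := hslab.smooth_slice _ ⟨le_rfl, hab'.le⟩
    have hfin_t : blockL2 (v (t - σ)) j ^ 2 ≠ ∞ :=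
      ENNReal.pow_ne_top ((hsm_t.blockFn j).memLp_two).eLpNorm_ne_top
    have hfin_s : blockL2 (v (s - σ)) j ^ 2 ≠ ∞ :=
      ENNReal.pow_ne_top ((hsm_s.blockFn j).memLp_two).eLpNorm_ne_top
    have hEt : ∫ x, ‖blockFn j (v (t - σ)) x‖ ^ 2 = (blockL2 (v (t - σ)) j ^ 2).toReal :=
      integral_norm_sq_eq_toReal_eLpNorm_sq ((hsm_t.blockFn j).memLp_two).1
    have hEs : ∫ x, ‖blockFn j (v (s - σ)) x‖ ^ 2 = (blockL2 (v (s - σ)) j ^ 2).toReal :=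
      integral_norm_sq_eq_toReal_eLpNorm_sq ((hsm_s.blockFn j).memLp_two).1
    -- the identity in `ℝ≥0∞`, viscous term dropped
    have hineq : blockL2 (v (t - σ)) j ^ 2 ≤ blockL2 (v (s - σ)) j ^ 2 +
        2 * ∫⁻ τ in Ioc (s - σ) (t - σ), G τ := by
      have h1 : (blockL2 (v (t - σ)) j ^ 2).toReal =
          (blockL2 (v (s - σ)) j ^ 2).toReal + 2 * ∫ τ in (s - σ)..(t - σ), g τ := by
        rw [← hEt, ← hEs]; linarith [hE]
      -- `ofReal (∫ g) ≤ ∫⁻ ofReal g ≤ ∫⁻ G`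
      have h2 : ENNReal.ofReal (∫ τ in (s - σ)..(t - σ), g τ) ≤ ∫⁻ τ in Ioc (s - σ) (t - σ), G τ := by
        rw [intervalIntegral.integral_of_le hab'.le]
        have h3 : ENNReal.ofReal (∫ τ in Ioc (s - σ) (t - σ), g τ) ≤
            ∫⁻ τ in Ioc (s - σ) (t - σ), ENNReal.ofReal (g τ) := by
          by_cases hgi : Integrable g (volume.restrict (Ioc (s - σ) (t - σ)))
          · calc ENNReal.ofReal (∫ τ in Ioc (s - σ) (t - σ), g τ)
                ≤ ENNReal.ofReal (∫ τ in Ioc (s - σ) (t - σ), max (g τ) 0) :=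
                  ENNReal.ofReal_le_ofReal (integral_mono hgi hgi.pos_part fun τ => le_max_left _ _)
              _ = ∫⁻ τ in Ioc (s - σ) (t - σ), ENNReal.ofReal (max (g τ) 0) :=
                  ofReal_integral_eq_lintegral_ofReal hgi.pos_part (Eventually.of_forall fun τ => le_max_right _ _)
              _ = ∫⁻ τ in Ioc (s - σ) (t - σ), ENNReal.ofReal (g τ) := lintegral_congr fun τ => by
                  rcases le_total (g τ) 0 with h | h
                  · rw [max_eq_right h, ENNReal.ofReal_zero, ENNReal.ofReal_of_nonpos h]
                  · rw [max_eq_left h]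
          · rw [integral_undef hgi, ENNReal.ofReal_zero]
            exact bot_le
        refine h3.trans (lintegral_mono fun τ => ENNReal.ofReal_le_ofReal ?_)
        have hS : 0 ≤ ν * (∑ i, ∫ x, ‖fderiv ℝ (blockFn j (v τ)) x
            (stdOrthonormalBasis ℝ (EuclideanSpace ℝ (Fin 3)) i)‖ ^ 2) :=
          mul_nonneg hν.le (Finset.sum_nonneg fun i _ => integral_nonneg fun x => by positivity)
        simp only [hg]
        linarith
      calc blockL2 (v (t - σ)) j ^ 2 = ENNReal.ofReal ((blockL2 (v (t - σ)) j ^ 2).toReal) :=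
            (ENNReal.ofReal_toReal hfin_t).symm
        _ = ENNReal.ofReal ((blockL2 (v (s - σ)) j ^ 2).toReal + 2 * ∫ τ in (s - σ)..(t - σ), g τ) := by
            rw [h1]
        _ ≤ ENNReal.ofReal ((blockL2 (v (s - σ)) j ^ 2).toReal) +
              ENNReal.ofReal (2 * ∫ τ in (s - σ)..(t - σ), g τ) := ENNReal.ofReal_add_le
        _ ≤ blockL2 (v (s - σ)) j ^ 2 + 2 * ∫⁻ τ in Ioc (s - σ) (t - σ), G τ := by
            rw [ENNReal.ofReal_toReal hfin_s, ENNReal.ofReal_mul zero_le_two, ENNReal.ofReal_ofNat]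
            gcongr
    -- translate `τ ↦ τ + σ` and return to `u`
    have htrans : ∫⁻ τ in Ioc (s - σ) (t - σ), G τ = ∫⁻ τ in Ioc s t, G (τ - σ) := by
      rw [← lintegral_indicator measurableSet_Ioc, ← lintegral_indicator measurableSet_Ioc,
        ← lintegral_sub_right_eq_self (fun τ => (Ioc (s - σ) (t - σ)).indicator G τ) σ]
      refine lintegral_congr fun τ => ?_
      by_cases h : τ ∈ Ioc s t
      · have h' : τ - σ ∈ Ioc (s - σ) (t - σ) := ⟨by linarith [h.1], by linarith [h.2]⟩
        rw [indicator_of_mem h, indicator_of_mem h']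
      · have h' : τ - σ ∉ Ioc (s - σ) (t - σ) := fun h' => h ⟨by linarith [h'.1], by linarith [h'.2]⟩
        rw [indicator_of_notMem h, indicator_of_notMem h']
    have hcongr : ∫⁻ τ in Ioc s t, G (τ - σ) = ∫⁻ τ in Ioc s t, ENNReal.ofReal
        (-(∫ x, ⟪blockFn j (u τ) x, blockFn j (convect (u τ) (u τ)) x⟫)) := by
      refine setLIntegral_congr_fun measurableSet_Ioc fun τ hτ => ?_
      have hτ' : u τ = v (τ - σ) := heq τ ⟨hs.trans hτ.1, hτ.2.trans htd⟩ (hτ.2.trans_lt htT)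
      simp only [hG, hτ']
    rw [hut, hus]
    rwa [htrans, hcongr] at hineq

/-! ## Smooth slices and the covered transport inequality along a maximal smooth solution -/

/-- **Slices of a maximal smooth finite-energy solution are smooth `L²` fields.** For a maximal smooth solution
`(u, p)` of the unforced system on `ℝ³ × [0, T)` (`ν > 0`) which is Leray–Hopf from `u 0`, every slice `u(τ)`,
`0 < τ < T`, has all derivatives bounded and square integrable. Proof: `u` is `H¹`-regular on `(0, T)`
(`IsMaximalSmoothSolution.isH1RegularOn_Ioo`), so Leray's regular local solutions from the good times of a compact
neighbourhood of `τ` have a uniform lifespan; one of them covers `τ` and coincides with `u` there (`piece_blockEnergy`).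
[cite: RobinsonRodrigoSadowski2016, Thm. 6.15 with Lemma 8.4] -/
theorem isSmoothL2Field_slice_of_maximal {ν T : ℝ} (hν : 0 < ν) (hT : 0 < T)
    {u : ℝ → EuclideanSpace ℝ (Fin 3) → EuclideanSpace ℝ (Fin 3)} {p : ℝ → EuclideanSpace ℝ (Fin 3) → ℝ}
    (hmax : IsMaximalSmoothSolution ν 0 u p T) (hLH : IsLerayHopfOn T ν 0 (u 0) u)
    {τ : ℝ} (hτ : τ ∈ Ioo 0 T) : IsSmoothL2Field (u τ) := by
  obtain ⟨c₀, hc₀, hreg⟩ := leray_local_regular_H1_holds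
  have hH1 : IsH1RegularOn (Ioo 0 T) u := hmax.isH1RegularOn_Ioo hν hT hLH
  obtain ⟨M, hM, hMK⟩ := hH1.exists_forall_le (isCompact_Icc : IsCompact (Icc (τ / 2) τ))
    fun t ht => ⟨by linarith [ht.1, hτ.1], ht.2.trans_lt hτ.2⟩
  set A : ℝ := M.toReal with hA
  set δ : ℝ := min (c₀ * ν ^ 3 / (A ^ 2 + 1)) (τ / 2) with hδ
  have hδpos : 0 < δ := lt_min (div_pos (by positivity) (by positivity)) (by linarith [hτ.1])
  have hδτ : δ ≤ τ / 2 := min_le_right _ _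
  have hAδ : A ^ 2 * δ ≤ c₀ * ν ^ 3 := by
    calc A ^ 2 * δ ≤ A ^ 2 * (c₀ * ν ^ 3 / (A ^ 2 + 1)) := by gcongr; exact min_le_left _ _
      _ = c₀ * ν ^ 3 * (A ^ 2 / (A ^ 2 + 1)) := by ring
      _ ≤ c₀ * ν ^ 3 * 1 := by gcongr; rw [div_le_one (by positivity)]; linarith
      _ = c₀ * ν ^ 3 := mul_one _
  -- a good time just before `τ`
  obtain ⟨σ, hσ, hLHσ⟩ := hLH.exists_isLerayHopfOn_restart_Ioo hν.le (a := τ - δ / 2) (b := τ)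
    (by linarith) (by linarith) hτ.2.le
  have hσT : σ ∈ Ioo 0 T := ⟨by linarith [hσ.1], hσ.2.trans hτ.2⟩
  have hAσ : eWeakGradL2Sq (u σ) ≤ ENNReal.ofReal A := by
    rw [hA, ENNReal.ofReal_toReal hM.ne]
    exact (le_add_self).trans ((eH1NormSq_def (u σ)).symm.le.trans (hMK σ ⟨by linarith [hσ.1], hσ.2.le⟩))
  set d : ℝ := min δ (T - σ) with hd
  have hdpos : 0 < d := lt_min hδpos (sub_pos.2 hσT.2)
  have hσd : σ + d ≤ T := by linarith [min_le_right δ (T - σ)]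
  have hAd : A ^ 2 * d ≤ c₀ * ν ^ 3 := (mul_le_mul_of_nonneg_left (min_le_left _ _) (sq_nonneg A)).trans hAδ
  obtain ⟨hsm, -⟩ := piece_blockEnergy hν hmax.1 hLH hreg hσT hLHσ ENNReal.toReal_nonneg hAσ hdpos hσd hAd
  refine hsm τ ⟨hσ.2, ?_⟩ hτ.2
  have : τ - σ ≤ d := le_min (by linarith [hσ.1]) (by linarith [hτ.2])
  linarith

/-- **The covered transport inequality.** For a maximal smooth solution `(u, p)` of the unforced system on
`ℝ³ × [0, T)` (`ν > 0`), Leray–Hopf from `u 0`, every `0 < s ≤ t < T` and every level `j`: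
`‖Δ̇_j u(t)‖₂² ≤ ‖Δ̇_j u(s)‖₂² + 2 ∫⁻_{(s,t]} (−N_j(u(τ)))⁺ dτ` with `N_j(w) = ∫ ⟪Δ̇_j w, Δ̇_j ((w·∇)w)⟫` — the energy a
block holds at time `t` is at most what it held at time `s` plus twice the positive part of the nonlinear transfer
into it in between (the viscous term only helps). Proof: a uniform `H¹` bound on `[s/2, t]` gives a uniform lifespan
`δ` for Leray's regular local solutions from good times; pieces of length `≤ δ/2` are handled by `piece_blockEnergy`
and chained, the lower integrals adding over adjacent intervals. [cite: CheskidovShvydkoy2010, Lemma 3.2 (proof, (8))] -/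
theorem blockL2_sq_le_add_transfer {ν T : ℝ} (hν : 0 < ν) (hT : 0 < T)
    {u : ℝ → EuclideanSpace ℝ (Fin 3) → EuclideanSpace ℝ (Fin 3)} {p : ℝ → EuclideanSpace ℝ (Fin 3) → ℝ}
    (hmax : IsMaximalSmoothSolution ν 0 u p T) (hLH : IsLerayHopfOn T ν 0 (u 0) u)
    {s t : ℝ} (hs : 0 < s) (hst : s ≤ t) (htT : t < T) (j : ℤ) :
    blockL2 (u t) j ^ 2 ≤ blockL2 (u s) j ^ 2 +
      2 * ∫⁻ τ in Ioc s t, ENNReal.ofReal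
        (-(∫ x, ⟪blockFn j (u τ) x, blockFn j (convect (u τ) (u τ)) x⟫)) := by
  set F : ℝ → ℝ≥0∞ := fun τ => ENNReal.ofReal
    (-(∫ x, ⟪blockFn j (u τ) x, blockFn j (convect (u τ) (u τ)) x⟫)) with hF
  obtain ⟨c₀, hc₀, hreg⟩ := leray_local_regular_H1_holds
  have hH1 : IsH1RegularOn (Ioo 0 T) u := hmax.isH1RegularOn_Ioo hν hT hLH
  obtain ⟨M, hM, hMK⟩ := hH1.exists_forall_le (isCompact_Icc : IsCompact (Icc (s / 2) t))
    fun τ hτ => ⟨by linarith [hτ.1], hτ.2.trans_lt htT⟩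
  set A : ℝ := M.toReal with hA
  set δ : ℝ := min (c₀ * ν ^ 3 / (A ^ 2 + 1)) (s / 2) with hδ
  have hδpos : 0 < δ := lt_min (div_pos (by positivity) (by positivity)) (by linarith)
  have hδs : δ ≤ s / 2 := min_le_right _ _
  have hAδ : A ^ 2 * δ ≤ c₀ * ν ^ 3 := by
    calc A ^ 2 * δ ≤ A ^ 2 * (c₀ * ν ^ 3 / (A ^ 2 + 1)) := by gcongr; exact min_le_left _ _
      _ = c₀ * ν ^ 3 * (A ^ 2 / (A ^ 2 + 1)) := by ring
      _ ≤ c₀ * ν ^ 3 * 1 := by gcongr; rw [div_le_one (by positivity)]; linarith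
      _ = c₀ * ν ^ 3 := mul_one _
  -- one piece of length `≤ δ/2`
  have single : ∀ s' t' : ℝ, s ≤ s' → s' ≤ t' → t' ≤ t → t' - s' ≤ δ / 2 →
      blockL2 (u t') j ^ 2 ≤ blockL2 (u s') j ^ 2 + 2 * ∫⁻ τ in Ioc s' t', F τ := by
    intro s' t' h1 h2 h3 h4
    obtain ⟨σ, hσ, hLHσ⟩ := hLH.exists_isLerayHopfOn_restart_Ioo hν.le (a := s' - δ / 2) (b := s')
      (by linarith) (by linarith) (by linarith)
    have hσT : σ ∈ Ioo 0 T := ⟨by linarith [hσ.1], by linarith [hσ.2]⟩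
    have hAσ : eWeakGradL2Sq (u σ) ≤ ENNReal.ofReal A := by
      rw [hA, ENNReal.ofReal_toReal hM.ne]
      exact (le_add_self).trans ((eH1NormSq_def (u σ)).symm.le.trans
        (hMK σ ⟨by linarith [hσ.1], by linarith [hσ.2]⟩))
    set d : ℝ := min δ (T - σ) with hd
    have hdpos : 0 < d := lt_min hδpos (sub_pos.2 hσT.2)
    have hσd : σ + d ≤ T := by linarith [min_le_right δ (T - σ)]
    have hAd : A ^ 2 * d ≤ c₀ * ν ^ 3 := (mul_le_mul_of_nonneg_left (min_le_left _ _) (sq_nonneg A)).trans hAδ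
    obtain ⟨-, hpiece⟩ := piece_blockEnergy hν hmax.1 hLH hreg hσT hLHσ ENNReal.toReal_nonneg hAσ hdpos hσd hAd
    refine hpiece s' t' hσ.2 h2 ?_ (h3.trans_lt htT) j
    have : t' - σ ≤ d := le_min (by linarith [hσ.1]) (by linarith)
    linarith
  -- chaining
  have cover : ∀ n : ℕ, ∀ s' t' : ℝ, s ≤ s' → s' ≤ t' → t' ≤ t → t' - s' ≤ n * (δ / 2) →
      blockL2 (u t') j ^ 2 ≤ blockL2 (u s') j ^ 2 + 2 * ∫⁻ τ in Ioc s' t', F τ := by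
    intro n
    induction n with
    | zero =>
      intro s' t' h1 h2 h3 h4
      have h5 : t' = s' := by simp only [Nat.cast_zero, zero_mul] at h4; linarith
      subst h5
      simp only [Ioc_self, Measure.restrict_empty, lintegral_zero_measure, mul_zero, add_zero, le_refl]
    | succ n ih =>
      intro s' t' h1 h2 h3 h4
      by_cases hshort : t' - s' ≤ δ / 2
      · exact single s' t' h1 h2 h3 hshort
      push Not at hshort
      set m : ℝ := s' + δ / 2 with hm
      have hsm := single s' m h1 (by linarith) (by linarith) (by simp [hm])
      have hmt := ih m t' (by linarith) (by linarith) h3 (by push_cast at h4 ⊢; linarith)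
      have hdisj : Disjoint (Ioc s' m) (Ioc m t') :=
        Set.disjoint_left.2 fun x hx hx' => lt_irrefl x (hx.2.trans_lt hx'.1)
      calc blockL2 (u t') j ^ 2 ≤ blockL2 (u m) j ^ 2 + 2 * ∫⁻ τ in Ioc m t', F τ := hmt
        _ ≤ (blockL2 (u s') j ^ 2 + 2 * ∫⁻ τ in Ioc s' m, F τ) + 2 * ∫⁻ τ in Ioc m t', F τ := by
            gcongr
        _ = blockL2 (u s') j ^ 2 + 2 * ∫⁻ τ in Ioc s' t', F τ := by
            rw [add_assoc, ← mul_add, ← lintegral_union measurableSet_Ioc hdisj,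
              Ioc_union_Ioc_eq_Ioc (by linarith) (by linarith)]
  obtain ⟨n, hn⟩ := exists_nat_ge ((t - s) / (δ / 2))
  refine cover n s t le_rfl hst le_rfl ?_
  have hδ2 : 0 < δ / 2 := by linarith
  rwa [div_le_iff₀ hδ2] at hn

end Summit.NavierStokesRegularity.FluidComputer.BlockEnergyTransport

end
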